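import Mathlib
import Summits.ValiantsHypothesis.ValiantsHypothesis.Theorems.StableRankCancellationDesignCounts
import HarnessLib

/-!
# Route StableRankCancellation — flatness of Reed–Solomon design tensors (item stmt-ValiantsHypothesis-10611)

`DesignFlat`: for `q = m+1` prime, `k ≤ d ≤ q`, the design polynomial
`NW = Σ_{cf : Fin k → 𝔽_q} ∏_{j<d} x_{j, p_cf(j)}` (`p_cf(j) = Σ_i cf_i j^i`) and every cut
`S ⊆ Fin d`: `q^e · |aᵀ M_S(NW) b|² ≤ ‖M_S(NW)‖_F² ‖a‖² ‖b‖²` with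
`e = min(k,|S|) + min(k,|Sᶜ|) − k`, where `M_S` is the tree's coefficient matrix `coeffMat ℂ S Sᶜ`.

Proof. `M_S[r,c]` is the NUMBER of coefficient vectors `cf` whose value table agrees with `r` on `S`
and with `c` on `Sᶜ` (`coeffMat_designPoly`, sibling helper file
`StableRankCancellationDesignCounts.lean`). Cauchy–Schwarz weighted by the nonnegative integer
matrix `M` gives `|aᵀMb|² ≤ (max row sum)·(max column sum)·‖a‖²‖b‖²` (`norm_sq_bilinear_le`); a row
sum counts the polynomials of degree `< k` over `𝔽_q` with prescribed values at the `|S|` distinct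
nodes of `S`, which is `≤ q^{k − min(k,|S|)}` (`card_filter_agree_le` in the helper file: Lagrange
interpolation is onto, then rank–nullity), and symmetrically for columns; the exponents add up to `k`, and
`‖M‖_F² ≥ Σ M = q^k`. No block decomposition of the support is needed.

* `designFlat_proof : DesignFlat` — the item, verbatim.

Honest framing: an unconditional combinatorial lemma filed as route bookkeeping (the route's cruxes
are open); nothing here is progress on VP ≠ VNP.

## References

* N. Nisan, A. Wigderson, *Hardness vs randomness*, JCSS 49 (1994) — the polynomial (Reed–Solomon)
  designs. [cite: NisanWigderson1994, §2]
* N. Kayal, C. Saha, R. Saptharishi, *A super-polynomial lower bound for regular arithmetic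
  formulas*, STOC 2014 — the design polynomial `NW` as a lower-bound witness.
  [cite: KayalSahaSaptharishi2014, §1]
-/

set_option linter.dupNamespace false

noncomputable section

open Finset MvPolynomial

namespace Summit.ValiantsHypothesis.ValiantsHypothesis.Theorems.StableRankCancellationDesign

open Literature.Computability.AlgebraicComplexity

/-! ### §3 Cauchy–Schwarz against a nonnegative integer matrix -/

/-- **Weighted Cauchy–Schwarz**: for a matrix of natural numbers `n` with row sums `≤ D_R` and
column sums `≤ D_C`, `|Σ a_r n_{rc} b_c|² ≤ D_R D_C ‖a‖² ‖b‖²`. [folklore] -/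
theorem norm_sq_bilinear_le {Row Col : Type*} [Fintype Row] [Fintype Col] (n : Row → Col → ℕ)
    (a : Row → ℂ) (b : Col → ℂ) (DR DC : ℕ) (hr : ∀ r, ∑ c, n r c ≤ DR)
    (hc : ∀ c, ∑ r, n r c ≤ DC) :
    ‖∑ r, ∑ c, a r * (n r c : ℂ) * b c‖ ^ 2 ≤
      (DR : ℝ) * DC * (∑ r, ‖a r‖ ^ 2) * (∑ c, ‖b c‖ ^ 2) := by
  -- `f (r,c) = ‖a r‖ √n`, `g (r,c) = ‖b c‖ √n`
  set f : Row × Col → ℝ := fun p => ‖a p.1‖ * Real.sqrt (n p.1 p.2) with hf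
  set g : Row × Col → ℝ := fun p => ‖b p.2‖ * Real.sqrt (n p.1 p.2) with hg
  have hsq : ∀ p : Row × Col, Real.sqrt (n p.1 p.2) * Real.sqrt (n p.1 p.2) = n p.1 p.2 :=
    fun p => Real.mul_self_sqrt (Nat.cast_nonneg _)
  have h1 : ‖∑ r, ∑ c, a r * (n r c : ℂ) * b c‖ ≤ ∑ p : Row × Col, f p * g p := by
    rw [Fintype.sum_prod_type]
    refine (norm_sum_le _ _).trans (sum_le_sum fun r _ => (norm_sum_le _ _).trans
      (sum_le_sum fun c _ => ?_))
    rw [norm_mul, norm_mul, Complex.norm_natCast, hf, hg]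
    simp only
    calc ‖a r‖ * (n r c : ℝ) * ‖b c‖
        = ‖a r‖ * ‖b c‖ * (Real.sqrt (n r c) * Real.sqrt (n r c)) := by rw [hsq (r, c)]; ring
      _ = ‖a r‖ * Real.sqrt (n r c) * (‖b c‖ * Real.sqrt (n r c)) := by ring
      _ ≤ _ := le_rfl
  have h2 : (∑ p : Row × Col, f p * g p) ^ 2 ≤
      (∑ p : Row × Col, f p ^ 2) * (∑ p : Row × Col, g p ^ 2) := sum_mul_sq_le_sq_mul_sq _ _ _
  have hf2 : ∑ p : Row × Col, f p ^ 2 ≤ (DR : ℝ) * ∑ r, ‖a r‖ ^ 2 := by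
    have : ∑ p : Row × Col, f p ^ 2 = ∑ r, ‖a r‖ ^ 2 * ∑ c, (n r c : ℝ) := by
      rw [Fintype.sum_prod_type]
      refine sum_congr rfl fun r _ => ?_
      rw [mul_sum]
      refine sum_congr rfl fun c _ => ?_
      rw [hf]
      simp only
      rw [mul_pow, Real.sq_sqrt (Nat.cast_nonneg _)]
    rw [this, mul_sum]
    refine sum_le_sum fun r _ => ?_
    rw [mul_comm (DR : ℝ)]
    refine mul_le_mul_of_nonneg_left ?_ (by positivity)
    exact_mod_cast hr r
  have hg2 : ∑ p : Row × Col, g p ^ 2 ≤ (DC : ℝ) * ∑ c, ‖b c‖ ^ 2 := by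
    have : ∑ p : Row × Col, g p ^ 2 = ∑ c, ‖b c‖ ^ 2 * ∑ r, (n r c : ℝ) := by
      rw [Fintype.sum_prod_type_right]
      refine sum_congr rfl fun c _ => ?_
      rw [mul_sum]
      refine sum_congr rfl fun r _ => ?_
      rw [hg]
      simp only
      rw [mul_pow, Real.sq_sqrt (Nat.cast_nonneg _)]
    rw [this, mul_sum]
    refine sum_le_sum fun c _ => ?_
    rw [mul_comm (DC : ℝ)]
    refine mul_le_mul_of_nonneg_left ?_ (by positivity)
    exact_mod_cast hc c
  have h0 : 0 ≤ ‖∑ r, ∑ c, a r * (n r c : ℂ) * b c‖ := norm_nonneg _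
  have hf0 : 0 ≤ ∑ p : Row × Col, f p ^ 2 := sum_nonneg fun p _ => by positivity
  calc ‖∑ r, ∑ c, a r * (n r c : ℂ) * b c‖ ^ 2
      ≤ (∑ p : Row × Col, f p * g p) ^ 2 := pow_le_pow_left₀ h0 h1 2
    _ ≤ (∑ p : Row × Col, f p ^ 2) * (∑ p : Row × Col, g p ^ 2) := h2
    _ ≤ ((DR : ℝ) * ∑ r, ‖a r‖ ^ 2) * ((DC : ℝ) * ∑ c, ‖b c‖ ^ 2) :=
        mul_le_mul hf2 hg2 (sum_nonneg fun p _ => by positivity) ((hf0.trans hf2))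
    _ = (DR : ℝ) * DC * (∑ r, ‖a r‖ ^ 2) * (∑ c, ‖b c‖ ^ 2) := by ring

/-! ### §4 The item -/

/-- **Route StableRankCancellation, item `DesignFlat` (stmt-ValiantsHypothesis-10611)**: flatness of
the Reed–Solomon design tensors, `q^e |aᵀ M_S(NW) b|² ≤ ‖M_S(NW)‖_F² ‖a‖² ‖b‖²`,
`e = min(k,|S|) + min(k,|Sᶜ|) − k`. Counting entries + weighted Cauchy–Schwarz + Lagrange/rank–nullity
(module docstring). [cite: NisanWigderson1994, §2] [cite: KayalSahaSaptharishi2014, §1] -/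
theorem designFlat_proof : Theses.StableRankCancellation.DesignFlat := by
  intro m d k hprime hkd hdq S a b
  classical
  haveI : Fact (m + 1).Prime := ⟨hprime⟩
  have hq : 0 < m + 1 := Nat.succ_pos m
  -- the entries of `M_S(NW)` are the counts
  simp_rw [coeffMat_designPoly (q := m + 1) S]
  set n : Assignment (fun _ : Fin d => ZMod (m + 1)) S →
      Assignment (fun _ : Fin d => ZMod (m + 1)) Sᶜ → ℕ := fun r c =>
    (univ.filter fun cf : Fin k → ZMod (m + 1) =>
      (r = fun j : S => ∑ i : Fin k, cf i * (((j : Fin d) : ℕ) : ZMod (m + 1)) ^ (i : ℕ)) ∧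
      (c = fun j : ↥(Sᶜ) => ∑ i : Fin k, cf i * (((j : Fin d) : ℕ) : ZMod (m + 1)) ^ (i : ℕ))).card
    with hn
  have hrow : ∀ r, ∑ c, n r c ≤ (m + 1) ^ (k - min k S.card) := fun r => by
    rw [hn]; simp only; rw [sum_card_agree_row]; exact card_agree_row_le hdq S r
  have hcol : ∀ c, ∑ r, n r c ≤ (m + 1) ^ (k - min k (d - S.card)) := fun c => by
    rw [hn]; simp only; rw [sum_card_agree_col]; exact card_agree_col_le hdq S c
  have htot : ∑ r, ∑ c, n r c = (m + 1) ^ k := by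
    rw [hn]; simp only; exact sum_sum_card_agree S
  -- Cauchy–Schwarz
  have hCS := norm_sq_bilinear_le n a b ((m + 1) ^ (k - min k S.card))
    ((m + 1) ^ (k - min k (d - S.card))) hrow hcol
  -- exponent bookkeeping: `e + (k - m₁) + (k - m₂) = k`
  have hS : S.card ≤ d := by simpa using S.card_le_univ
  have hexp : (min k S.card + min k (d - S.card) - k) + (k - min k S.card) +
      (k - min k (d - S.card)) = k := by omega
  have hpow : ((m + 1 : ℕ) : ℝ) ^ (min k S.card + min k (d - S.card) - k) *
      ((((m + 1) ^ (k - min k S.card) : ℕ) : ℝ) * (((m + 1) ^ (k - min k (d - S.card)) : ℕ) : ℝ)) =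
      ((m + 1 : ℕ) : ℝ) ^ k := by
    push_cast
    rw [← pow_add, ← pow_add, ← add_assoc, hexp]
  -- `q^k = Σ n ≤ Σ n² = ‖M‖_F²`
  have hfrob : ((m + 1 : ℕ) : ℝ) ^ k ≤ ∑ r, ∑ c, ‖((n r c : ℕ) : ℂ)‖ ^ 2 := by
    have h1 : ((m + 1 : ℕ) : ℝ) ^ k = ∑ r, ∑ c, (n r c : ℝ) := by
      have := congrArg (fun x : ℕ => (x : ℝ)) htot
      push_cast at this
      exact_mod_cast this.symm
    rw [h1]
    refine sum_le_sum fun r _ => sum_le_sum fun c _ => ?_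
    rw [Complex.norm_natCast]
    exact_mod_cast Nat.le_self_pow two_ne_zero (n r c)
  have ha : 0 ≤ ∑ r, ‖a r‖ ^ 2 := sum_nonneg fun _ _ => by positivity
  have hb : 0 ≤ ∑ c, ‖b c‖ ^ 2 := sum_nonneg fun _ _ => by positivity
  calc ((m + 1 : ℕ) : ℝ) ^ (min k S.card + min k (d - S.card) - k) *
        ‖∑ r, ∑ c, a r * ((n r c : ℕ) : ℂ) * b c‖ ^ 2
      ≤ ((m + 1 : ℕ) : ℝ) ^ (min k S.card + min k (d - S.card) - k) *
        ((((m + 1) ^ (k - min k S.card) : ℕ) : ℝ) * (((m + 1) ^ (k - min k (d - S.card)) : ℕ) : ℝ) *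
          (∑ r, ‖a r‖ ^ 2) * (∑ c, ‖b c‖ ^ 2)) :=
        mul_le_mul_of_nonneg_left hCS (by positivity)
    _ = ((m + 1 : ℕ) : ℝ) ^ k * (∑ r, ‖a r‖ ^ 2) * (∑ c, ‖b c‖ ^ 2) := by
        rw [← hpow]; ring
    _ ≤ (∑ r, ∑ c, ‖((n r c : ℕ) : ℂ)‖ ^ 2) * (∑ r, ‖a r‖ ^ 2) * (∑ c, ‖b c‖ ^ 2) := by
        gcongr

end Summit.ValiantsHypothesis.ValiantsHypothesis.Theorems.StableRankCancellationDesign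

end
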